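import Literature.NumberTheory.LFunctions.RudnickSarnakDeterminant
import Mathlib.Analysis.Normed.Module.FiniteDimension
import HarnessLib

/-!
# Uniqueness of `Φ` on the hyperplane from `f_Φ`; Schwartz slices of pull-backs

Z. Rudnick, P. Sarnak, Duke Math. J. **81** (1996), (3.6) and (4.14). The test function
`f_Φ(x) = ∫ Φ(ξ) δ(∑ξ) e(-x·ξ) dξ` only sees the restriction of `Φ` to the hyperplane
`∑ ξ_j = 0`, and conversely determines it there: by Fourier inversion on the hyperplane,

* `integral_slice_mul_cexp_eq_of_continuous` : `Φ(-∑w, w) = ∫ f_Φ(0, y) e(y·w) dy`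

for continuous compactly supported `Φ` whose slice `f_Φ(0, ·)` is a Schwartz function
(the tree's `RudnickSarnak.integral_slice_mul_cexp_eq` assumed `Φ` admissible); hence two such
`Φ` with the same `f_Φ` agree on the hyperplane (`eq_on_hyperplane_of_rsPhiTest_eq`). This is what
makes the pairing functional `∫ Φ' C_O` (RS (3.9)) of *any* admissible representative `Φ'` of a
pulled-back test function `ι_Q^* f_Φ` computable from the fibre integrals of `Φ` ((4.14)). The
Schwartz hypothesis for pull-backs is supplied by `exists_schwartz_pulledSlice`: the slice of
`ι^* f = f ∘ (· ∘ ι)` is the Schwartz slice of `f` composed with an injective linear map.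

## References

* Z. Rudnick, P. Sarnak, Duke Math. J. 81 (1996), (3.6), (4.14).
-/

noncomputable section

open Complex MeasureTheory Finset
open scoped Real FourierTransform

namespace Literature.NumberTheory.LFunctions

namespace RudnickSarnak

variable {k m : ℕ}

/-! ## The slice of a continuous compactly supported `Φ` -/

/-- The hyperplane slice `η ↦ Φ(-∑η, η)` of a continuous `Φ` is continuous. [folklore] -/
theorem continuous_slice_of_continuous {Φ : (Fin (k + 1) → ℝ) → ℂ} (hΦ : Continuous Φ) :
    Continuous fun η : Fin k → ℝ ↦ Φ (Fin.cons (-∑ i, η i) η) := by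
  refine hΦ.comp ?_
  refine continuous_pi fun j ↦ ?_
  refine Fin.cases ?_ (fun i ↦ ?_) j
  · simp only [Fin.cons_zero]
    exact (continuous_finsetSum _ fun i _ ↦ continuous_apply i).neg
  · simp only [Fin.cons_succ]
    exact continuous_apply i

/-- The hyperplane slice of a compactly supported `Φ` has compact support (`‖η‖ ≤ ‖(-∑η, η)‖`).
[folklore] -/
theorem hasCompactSupport_slice_of_hasCompactSupport {Φ : (Fin (k + 1) → ℝ) → ℂ}
    (hΦ : HasCompactSupport Φ) :
    HasCompactSupport fun η : Fin k → ℝ ↦ Φ (Fin.cons (-∑ i, η i) η) := by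
  obtain ⟨R, hR⟩ := hΦ.isCompact.isBounded.subset_closedBall 0
  refine HasCompactSupport.of_support_subset_isCompact (isCompact_closedBall (0 : Fin k → ℝ) R)
    fun η hη ↦ ?_
  have hmem := hR (subset_tsupport _ (Function.mem_support.2 hη))
  rw [Metric.mem_closedBall, dist_zero_right] at hmem ⊢
  refine le_trans ?_ hmem
  rw [pi_norm_le_iff_of_nonneg (norm_nonneg _)]
  intro i
  have := norm_le_pi_norm (Fin.cons (-∑ i, η i) η : Fin (k + 1) → ℝ) i.succ
  simpa using this

/-- **Fourier inversion on the hyperplane** for continuous compactly supported `Φ` with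
Schwartz slice `F = f_Φ(0, ·)`: `∫ F(y) e^{2πi y·w} dy = Φ(-∑w, w)`.
[cite: RudnickSarnak1996, (3.6)] -/
theorem integral_slice_mul_cexp_eq_of_continuous {Φ : (Fin (k + 1) → ℝ) → ℂ} (hΦc : Continuous Φ)
    (hΦs : HasCompactSupport Φ)
    (hslice : ∃ g : SchwartzMap (Fin k → ℝ) ℂ, ⇑g = rsSlice (rsPhiTest Φ)) (w : Fin k → ℝ) :
    (∫ y : Fin k → ℝ, rsSlice (rsPhiTest Φ) y * Complex.exp (2 * π * I * ∑ i, (y i * w i : ℝ))) =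
      Φ (Fin.cons (-∑ i, w i) w) := by
  obtain ⟨g, hg⟩ := hslice
  set e : EuclideanSpace ℝ (Fin k) ≃L[ℝ] (Fin k → ℝ) :=
    PiLp.continuousLinearEquiv 2 ℝ (fun _ : Fin k ↦ ℝ) with he
  set ΦE : EuclideanSpace ℝ (Fin k) → ℂ :=
    fun v ↦ Φ (Fin.cons (-∑ i, (WithLp.ofLp v) i) (WithLp.ofLp v)) with hΦE
  have hΦEc : Continuous ΦE := (continuous_slice_of_continuous hΦc).comp e.continuous
  have hΦEs : HasCompactSupport ΦE :=
    (hasCompactSupport_slice_of_hasCompactSupport hΦs).comp_isClosedEmbedding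
      e.toHomeomorph.isClosedEmbedding
  have hΦEi : Integrable ΦE := hΦEc.integrable_of_hasCompactSupport hΦEs
  set G : SchwartzMap (EuclideanSpace ℝ (Fin k)) ℂ :=
    SchwartzMap.compCLMOfContinuousLinearEquiv ℂ e g with hG
  have hGcoe : (⇑G : EuclideanSpace ℝ (Fin k) → ℂ) = fun v ↦ g (WithLp.ofLp v) := rfl
  have hFG : 𝓕 ΦE = ⇑G := by
    funext v
    have hv : v = WithLp.toLp 2 (WithLp.ofLp v) := rfl
    rw [hv, hΦE, fourier_euclidean_toLp (fun η ↦ Φ (Fin.cons (-∑ i, η i) η)), hGcoe]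
    beta_reduce
    rw [WithLp.ofLp_toLp, hg, rsSlice_rsPhiTest]
    congr 1
    funext η
    congr 2
    simp only [mul_comm]
  have hFGi : Integrable (𝓕 ΦE) := by
    rw [hFG]
    exact G.integrable
  have hinv := hΦEc.fourierInv_fourier_eq hΦEi hFGi
  have hw : ΦE (WithLp.toLp 2 w) = Φ (Fin.cons (-∑ i, w i) w) := rfl
  rw [← hw, ← hinv, hFG, hGcoe, fourierInv_euclidean_toLp, hg]

/-- **`f_Φ` determines `Φ` on the hyperplane**: two continuous compactly supported `Φ₁, Φ₂` with
`f_{Φ₁} = f_{Φ₂}` and Schwartz slice agree on `∑ ξ_j = 0`. [cite: RudnickSarnak1996, (3.6)] -/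
theorem eq_on_hyperplane_of_rsPhiTest_eq {Φ₁ Φ₂ : (Fin (k + 1) → ℝ) → ℂ} (h₁c : Continuous Φ₁)
    (h₁s : HasCompactSupport Φ₁) (h₂c : Continuous Φ₂) (h₂s : HasCompactSupport Φ₂)
    (heq : rsPhiTest Φ₁ = rsPhiTest Φ₂)
    (hslice : ∃ g : SchwartzMap (Fin k → ℝ) ℂ, ⇑g = rsSlice (rsPhiTest Φ₁)) (w : Fin k → ℝ) :
    Φ₁ (Fin.cons (-∑ i, w i) w) = Φ₂ (Fin.cons (-∑ i, w i) w) := by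
  rw [← integral_slice_mul_cexp_eq_of_continuous h₁c h₁s hslice w,
    ← integral_slice_mul_cexp_eq_of_continuous h₂c h₂s (heq ▸ hslice) w, heq]

/-- A point of the hyperplane `∑ ζ_b = 0` is `(-∑ tail, tail)`. [folklore] -/
theorem cons_neg_sum_tail_eq {ζ : Fin (k + 1) → ℝ} (hζ : ∑ b, ζ b = 0) :
    (Fin.cons (-∑ i : Fin k, ζ i.succ) (fun i ↦ ζ i.succ) : Fin (k + 1) → ℝ) = ζ := by
  funext j
  refine Fin.cases ?_ (fun i ↦ ?_) j
  · rw [Fin.sum_univ_succ] at hζ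
    simp only [Fin.cons_zero]
    linarith
  · simp

/-- The value version on the hyperplane: if `∑ ζ_b = 0` then `Φ₁ ζ = Φ₂ ζ`.
[cite: RudnickSarnak1996, (3.6)] -/
theorem eq_of_rsPhiTest_eq_of_sum_eq_zero {Φ₁ Φ₂ : (Fin (k + 1) → ℝ) → ℂ} (h₁c : Continuous Φ₁)
    (h₁s : HasCompactSupport Φ₁) (h₂c : Continuous Φ₂) (h₂s : HasCompactSupport Φ₂)
    (heq : rsPhiTest Φ₁ = rsPhiTest Φ₂)
    (hslice : ∃ g : SchwartzMap (Fin k → ℝ) ℂ, ⇑g = rsSlice (rsPhiTest Φ₁))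
    {ζ : Fin (k + 1) → ℝ} (hζ : ∑ b, ζ b = 0) : Φ₁ ζ = Φ₂ ζ := by
  have := eq_on_hyperplane_of_rsPhiTest_eq h₁c h₁s h₂c h₂s heq hslice (fun i ↦ ζ i.succ)
  rwa [cons_neg_sum_tail_eq hζ] at this

/-! ## The slice of a pull-back is a Schwartz function -/

/-- The linear map behind the slice of a pull-back: `y' ↦ (x_{ι(i+1)} - x_{ι 0})_i` with
`x = (0, y')`. [folklore] -/
def pulledSliceMap (ι : Fin (k + 1) → Fin (m + 1)) : (Fin m → ℝ) →L[ℝ] (Fin k → ℝ) :=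
  LinearMap.toContinuousLinearMap
    { toFun := fun y' i ↦ (Fin.cons 0 y' : Fin (m + 1) → ℝ) (ι i.succ) - (Fin.cons 0 y' : Fin (m + 1) → ℝ) (ι 0)
      map_add' := fun y₁ y₂ ↦ by
        funext i
        simp only [Pi.add_apply]
        have h : (Fin.cons 0 (y₁ + y₂) : Fin (m + 1) → ℝ) =
            (Fin.cons 0 y₁ : Fin (m + 1) → ℝ) + Fin.cons 0 y₂ := by
          funext j
          refine Fin.cases ?_ (fun i ↦ ?_) j <;> simp
        rw [h]
        simp only [Pi.add_apply]
        ring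
      map_smul' := fun c y ↦ by
        funext i
        simp only [Pi.smul_apply, smul_eq_mul, RingHom.id_apply]
        have h : (Fin.cons 0 (c • y) : Fin (m + 1) → ℝ) = c • (Fin.cons 0 y : Fin (m + 1) → ℝ) := by
          funext j
          refine Fin.cases ?_ (fun i ↦ ?_) j <;> simp
        rw [h]
        simp only [Pi.smul_apply, smul_eq_mul]
        ring }

/-- [folklore] -/
theorem pulledSliceMap_apply (ι : Fin (k + 1) → Fin (m + 1)) (y' : Fin m → ℝ) (i : Fin k) :
    pulledSliceMap ι y' i =
      (Fin.cons 0 y' : Fin (m + 1) → ℝ) (ι i.succ) - (Fin.cons 0 y' : Fin (m + 1) → ℝ) (ι 0) := rfl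

/-- The slice map of a pull-back along a surjective labelling is injective. [folklore] -/
theorem pulledSliceMap_injective {ι : Fin (k + 1) → Fin (m + 1)} (hιs : Function.Surjective ι) :
    Function.Injective (pulledSliceMap ι) := by
  refine (injective_iff_map_eq_zero _).2 fun y' hy ↦ ?_
  -- all coordinates of `(0, y') ∘ ι` equal the `ι 0` coordinate, which is then `0`
  set c := (Fin.cons 0 y' : Fin (m + 1) → ℝ) (ι 0) with hc
  have hall : ∀ a : Fin (k + 1), (Fin.cons 0 y' : Fin (m + 1) → ℝ) (ι a) = c := by
    intro a
    refine Fin.cases rfl (fun i ↦ ?_) a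
    have := congrFun hy i
    rw [pulledSliceMap_apply, Pi.zero_apply] at this
    linarith
  have hc0 : c = 0 := by
    obtain ⟨a, ha⟩ := hιs 0
    have := hall a
    rw [ha] at this
    simpa using this.symm
  funext j
  obtain ⟨a, ha⟩ := hιs j.succ
  have := hall a
  rw [ha, hc0] at this
  simpa using this

/-- **The slice of a pull-back is Schwartz.** If `f` is invariant under diagonal translation
(TF 2) with Schwartz slice `g = f(0, ·)`, and `ι` is a surjective labelling, then the slice
`y' ↦ f((0, y') ∘ ι)` of `ι^* f` is the Schwartz function `g ∘ L`, `L` the injective linear map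
`pulledSliceMap ι`. [cite: RudnickSarnak1996, (4.14)] -/
theorem exists_schwartz_pulledSlice {f : (Fin (k + 1) → ℝ) → ℂ}
    (hdiag : ∀ (x : Fin (k + 1) → ℝ) (t : ℝ), f (fun i ↦ x i + t) = f x)
    (hslice : ∃ g : SchwartzMap (Fin k → ℝ) ℂ, ⇑g = rsSlice f)
    {ι : Fin (k + 1) → Fin (m + 1)} (hιs : Function.Surjective ι) :
    ∃ g' : SchwartzMap (Fin m → ℝ) ℂ,
      ⇑g' = rsSlice (fun z : Fin (m + 1) → ℝ ↦ f (fun a ↦ z (ι a))) := by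
  obtain ⟨g, hg⟩ := hslice
  set L := pulledSliceMap ι with hL
  have hker : LinearMap.ker (L : (Fin m → ℝ) →ₗ[ℝ] (Fin k → ℝ)) = ⊥ :=
    LinearMap.ker_eq_bot.2 (pulledSliceMap_injective hιs)
  obtain ⟨K, -, hK⟩ := LinearMap.exists_antilipschitzWith (L : (Fin m → ℝ) →ₗ[ℝ] (Fin k → ℝ)) hker
  refine ⟨SchwartzMap.compCLMOfAntilipschitz ℂ (g := (L : (Fin m → ℝ) → (Fin k → ℝ)))
    L.hasTemperateGrowth hK g, ?_⟩
  rw [SchwartzMap.compCLMOfAntilipschitz_apply]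
  funext y'
  simp only [Function.comp_apply, rsSlice]
  -- `f((0,y') ∘ ι) = f((0,y') ∘ ι - c) = g (L y')` by diagonal invariance
  set x : Fin (k + 1) → ℝ := fun a ↦ (Fin.cons 0 y' : Fin (m + 1) → ℝ) (ι a) with hx
  have h1 : f x = f (fun a ↦ x a + -(x 0)) := (hdiag x (-(x 0))).symm
  have h2 : (fun a ↦ x a + -(x 0)) = Fin.cons 0 (L y') := by
    funext a
    refine Fin.cases ?_ (fun i ↦ ?_) a
    · simp
    · simp [hx, hL, pulledSliceMap_apply, sub_eq_add_neg]
  rw [h1, h2, show f (Fin.cons 0 (L y')) = rsSlice f (L y') from rfl, ← hg]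

end RudnickSarnak

end Literature.NumberTheory.LFunctions

end
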